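import Summits.ResolutionOfSingularities.ResolutionOfSingularities.Theorems.EquisingularLiftEquisingularLiftNatDepthModel
import Summits.ResolutionOfSingularities.ResolutionOfSingularities.Theorems.EquisingularLiftEquisingularLiftNatDepthClosedPoints
import Literature.AlgebraicGeometry.Resolution.RegularBlowup
import HarnessLib

/-!
# [OURS] REGULAR CLOSED POINTS HAVE DEPTH `0` — the tower semantics is sound at the regular points (Liu 8.1.19 (a) on a regular open neighbourhood)
# (cruxes `Theses.EquisingularLift.EquisingularLiftNat` / `…NatThree`, stmt-ResolutionOfSingularities-20038 / -20148)

[OURS · leafhand-res-equisingularlift-10 g1, 2026-08-31; cell `pub/decomp-res`] AI-produced, weaker than expert review; NOT a statement of any manuscript;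
nothing here proves resolution of singularities in positive characteristic.  DEF-FREE helper; no `sorry`; standard axioms; ZERO named hypotheses.

The depth theorems only ask levels at NON-REGULAR points.  For the record (and as a sanity check of the tower semantics) regular closed points have level `0`:

* ★ `isRegular_subscheme_vanishingIdeal_singleton` — the reduced closed point `V({y})_red` is a regular scheme (one-point integral scheme: its local ring is
  its function field);
* ★★ `towerLevel_zero_of_regular_nbhd` — `Γ` locally Noetherian, `y` a closed point with a REGULAR open neighbourhood `U` ⟹ `D 0 Γ y` for every blow-up tower
  `D`: the blow-up of `U` at the reduced point is regular (tree ✓ `IsBlowup.isRegular_of_isRegular_subscheme`, Liu 8.1.19 (a)), ONE MODEL SUFFICES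
  (✓ `towerLevel_zero_of_model`), and the level moves from `U` to `Γ` by LOCALITY (✓ `tower_loc` along `U.ι`);
* ★★ `towerLevel_zero_of_isRegularLocalRing` — `H → Spec k` locally of finite type, `x` a closed point with `𝒪_{H,x}` regular ⟹ `D 0 H x` (the regular locus is
  OPEN, tree ✓ `isOpen_regularLocus_of_locallyOfFiniteType_field`, and regular as an open subscheme).

So for `H ⊆ ℙⁿ_k̄` with finite non-regular locus «every closed point has a level» ⟺ «every non-regular point has a level».  Honest label: closes no registered stub.

References: [Liu2002, Thm. 8.1.19 (a)]; [Matsumura1987, Thm. 30.5]; [GortzWedhorn2020, (13.19)] — through the cited tree files.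
-/

set_option linter.dupNamespace false -- mandated namespace `Summit.<Summit>.<Problem>` of this single-conjunct summit

noncomputable section

open CategoryTheory CategoryTheory.Limits AlgebraicGeometry TopologicalSpace
open Literature.AlgebraicGeometry.Resolution Literature.AlgebraicGeometry.Motives
open AlgebraicGeometry.Scheme.IdealSheafData

namespace Summit.ResolutionOfSingularities.ResolutionOfSingularities.Cruxes.EquisingularLiftNat.Sections

universe u

/-- ★ **The reduced closed point is a regular scheme**: `V({y})_red` is integral with a single point, so its local ring there is its function field. [folklore] -/
theorem isRegular_subscheme_vanishingIdeal_singleton {X : Scheme.{u}} (y : X) (hy : IsClosed (({y} : Set X))) :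
    Scheme.IsRegular (vanishingIdeal (⟨{y}, hy⟩ : Closeds X)).subscheme := by
  haveI : IsIntegral (vanishingIdeal (⟨{y}, hy⟩ : Closeds X)).subscheme :=
    isIntegral_subscheme_vanishingIdeal _ isIrreducible_singleton
  intro x
  have hr : ∀ z : ↥(vanishingIdeal (⟨{y}, hy⟩ : Closeds X)).subscheme, (vanishingIdeal (⟨{y}, hy⟩ : Closeds X)).subschemeι z = y := by
    intro z
    have h : (vanishingIdeal (⟨{y}, hy⟩ : Closeds X)).subschemeι z ∈ Set.range (vanishingIdeal (⟨{y}, hy⟩ : Closeds X)).subschemeι := ⟨z, rfl⟩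
    rw [Scheme.IdealSheafData.range_subschemeι, Scheme.IdealSheafData.coe_support_vanishingIdeal] at h
    exact Set.mem_singleton_iff.mp h
  have hx : x = genericPoint ↥(vanishingIdeal (⟨{y}, hy⟩ : Closeds X)).subscheme :=
    (vanishingIdeal (⟨{y}, hy⟩ : Closeds X)).subschemeι.isClosedEmbedding.injective (by rw [hr x, hr (genericPoint _)])
  rw [hx]
  exact inferInstanceAs (IsRegularLocalRing (Scheme.functionField _))

/-- ★★ **A CLOSED POINT WITH A REGULAR OPEN NEIGHBOURHOOD HAS LEVEL `0`** in every blow-up tower `D`: the blow-up of the regular neighbourhood `U` at the reduced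
point is regular (Liu 8.1.19 (a)), one model suffices, and the level passes from `U` to `Γ` by locality. [OURS] [cite: Liu2002, Thm. 8.1.19 (a)]
[cite: GortzWedhorn2020, (13.19)] -/
theorem towerLevel_zero_of_regular_nbhd (D : ℕ → ∀ Γ : Scheme.{0}, Γ → Prop)
    (hD0 : ∀ (Γ : Scheme.{0}) (y : Γ), IsClosed (({y} : Set Γ)) →
      (D 0 Γ y ↔ ∀ (hy : IsClosed (({y} : Set Γ))) (Z : Scheme.{0}) (τ : Z ⟶ Γ), IsBlowup τ (vanishingIdeal ⟨{y}, hy⟩) →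
        ∀ z : Z, τ z = y → IsRegularLocalRing (Z.presheaf.stalk z)))
    (hDsucc : ∀ (d : ℕ) (Γ : Scheme.{0}) (y : Γ), IsClosed (({y} : Set Γ)) →
      (D (d + 1) Γ y ↔ ∀ (hy : IsClosed (({y} : Set Γ))) (Z : Scheme.{0}) (τ : Z ⟶ Γ), IsBlowup τ (vanishingIdeal ⟨{y}, hy⟩) →
        ∃ S' : Finset Z, (∀ z : Z, τ z = y → z ∉ S' → IsRegularLocalRing (Z.presheaf.stalk z)) ∧
          ∀ z ∈ S', τ z = y ∧ IsClosed (({z} : Set Z)) ∧ ∃ d' ≤ d, D d' Z z))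
    {Γ : Scheme.{0}} [IsLocallyNoetherian Γ] (U : Γ.Opens) (hU : Scheme.IsRegular (U : Scheme.{0})) {y : Γ} (hyU : y ∈ U)
    (hy : IsClosed (({y} : Set Γ))) : D 0 Γ y := by
  obtain ⟨u₀, hu₀⟩ : ∃ u₀ : (U : Scheme.{0}), U.ι u₀ = y := ⟨⟨y, hyU⟩, rfl⟩
  have hu₀cl : IsClosed (({u₀} : Set (U : Scheme.{0}))) := PointChain.isClosed_singleton_of_openι_eq U hy u₀ hu₀
  -- the model: the blow-up of `U` at the reduced point `u₀`, a regular scheme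
  have hbl := blowup.isBlowup (vanishingIdeal (⟨{u₀}, hu₀cl⟩ : Closeds (U : Scheme.{0})))
  have hreg : Scheme.IsRegular (blowup (vanishingIdeal (⟨{u₀}, hu₀cl⟩ : Closeds (U : Scheme.{0})))) :=
    hbl.isRegular_of_isRegular_subscheme hU (isRegular_subscheme_vanishingIdeal_singleton u₀ hu₀cl)
  have h0 : D 0 (U : Scheme.{0}) u₀ :=
    towerLevel_zero_of_model D hD0 hu₀cl _ (blowup.π _) hbl (fun z _ => hreg z)
  -- locality along `U.ι`
  haveI := PointChain.isIso_ι_morphismRestrict_self U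
  exact (tower_loc D hD0 hDsucc 0 Γ (U : Scheme.{0}) U.ι U inferInstance y hyU hy u₀ hu₀ hu₀cl).mpr h0

/-- ★★ **A REGULAR CLOSED POINT OF A SCHEME LOCALLY OF FINITE TYPE OVER A FIELD HAS LEVEL `0`** in every blow-up tower `D` (the regular locus is an open,
regular neighbourhood: fields are J-2). [OURS] [cite: Matsumura1987, Thm. 30.5] [cite: Liu2002, Thm. 8.1.19 (a)] -/
theorem towerLevel_zero_of_isRegularLocalRing (D : ℕ → ∀ Γ : Scheme.{0}, Γ → Prop)
    (hD0 : ∀ (Γ : Scheme.{0}) (y : Γ), IsClosed (({y} : Set Γ)) →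
      (D 0 Γ y ↔ ∀ (hy : IsClosed (({y} : Set Γ))) (Z : Scheme.{0}) (τ : Z ⟶ Γ), IsBlowup τ (vanishingIdeal ⟨{y}, hy⟩) →
        ∀ z : Z, τ z = y → IsRegularLocalRing (Z.presheaf.stalk z)))
    (hDsucc : ∀ (d : ℕ) (Γ : Scheme.{0}) (y : Γ), IsClosed (({y} : Set Γ)) →
      (D (d + 1) Γ y ↔ ∀ (hy : IsClosed (({y} : Set Γ))) (Z : Scheme.{0}) (τ : Z ⟶ Γ), IsBlowup τ (vanishingIdeal ⟨{y}, hy⟩) →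
        ∃ S' : Finset Z, (∀ z : Z, τ z = y → z ∉ S' → IsRegularLocalRing (Z.presheaf.stalk z)) ∧
          ∀ z ∈ S', τ z = y ∧ IsClosed (({z} : Set Z)) ∧ ∃ d' ≤ d, D d' Z z))
    {k : Type} [Field k] {H : Scheme.{0}} (f : H ⟶ Spec (.of k)) [LocallyOfFiniteType f]
    (x : H) (hx : IsRegularLocalRing (H.presheaf.stalk x)) (hxcl : IsClosed (({x} : Set H))) : D 0 H x := by
  haveI : IsLocallyNoetherian H := LocallyOfFiniteType.isLocallyNoetherian f
  let U : H.Opens := ⟨Scheme.regularLocus H, isOpen_regularLocus_of_locallyOfFiniteType_field f⟩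
  have hxU : x ∈ U := hx
  have hU : Scheme.IsRegular (U : Scheme.{0}) := by
    intro u
    have hu : IsRegularLocalRing (H.presheaf.stalk (U.ι u)) := u.2
    exact IsRegularLocalRing.of_ringEquiv (R := H.presheaf.stalk (U.ι u)) (asIso ((U.ι).stalkMap u)).commRingCatIsoToRingEquiv
  exact towerLevel_zero_of_regular_nbhd D hD0 hDsucc U hU hxU hxcl

end Summit.ResolutionOfSingularities.ResolutionOfSingularities.Cruxes.EquisingularLiftNat.Sections

end
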